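import Summits.BirchSwinnertonDyer.BirchSwinnertonDyer.Theorems.KimAtThreeDeepLowerWitnessPairStablePow
import Summits.BirchSwinnertonDyer.BirchSwinnertonDyer.Theorems.KimAtThreeDeepUpperWitnessOfZetaBodyStable
import Summits.BirchSwinnertonDyer.BirchSwinnertonDyer.Theorems.KimAtThreeDeepUpperValueRowsAnomalous
import HarnessLib

/-!
# Route `KimAtThreeKolyvagin` (rung W2), cruxes `DeepLowerAtThree` (19075) / `DeepUpperAtThree` (19076) and their
# off-stratum children: the DEEP-GUARD TWO-DEPTH PORT of this seat's gen-6 rows DISCHARGED per row from Kato's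
# `ZetaBody` — any reduction type at `3`, any `3`-torsion of `E(ℚ₃)`

Cell `bsd-addord`, seat `bsd-addord-w2-c2` gen 7 (D-0074 row B5); `--supports` stmt-BirchSwinnertonDyer-19075.
TOOL THEOREMS ONLY: no definition, no named fact, no instance, no `sorry`; Kato's `ZetaBody` (witnesses BOUND),
the finite-level (Λ)-clauses, the two-exponent riders (ii₂) and (in §1) the per-level value rows are DISPLAYED
hypotheses; nothing asserted about any curve; nothing booked; the cruxes stay OPEN; BSD is not proved by this.

## What and why

This seat's gen-6 rows `KimAtThreeDeepLowerPortDeepTorsion.deepLower_row_of_portDeep_tors` (LOWER: `∃ d,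
∂^{(∞)}_deep = d ∧ ∂⁽⁰⁾ ≤ ord₃ #Ш(3) + d`) and `KimAtThreeDeepLowerPortDeepTorsionUpper.deepUpper_row_of_portDeep_tors`
(UPPER) hold at EVERY `3`-adic-tower row of analytic rank `0` GRANTED [S24] Thm. 4.4 (1)(2) (pinned), GZK,
Poitou–Tate and ONE deep-guard two-depth port at `(t, e, M)`:
«for all depths `k ≤ k′`, all `τ`-data `Dk`/`Dk′` canonical for `η` with primes in the Frobenius classes of depth
`k + M` / `k′ + M` (n1011 (B6) guards `IsCanonicalTauDatumThreeAtWith W (k + M) k η`), every pinned reduction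
`red`: two-exponent witnesses `KatoKuriharaWitnessAtTwoExp W k t e Dk …` / `… k′ t e Dk′ …` + (COMP)».
**This file DISCHARGES that port, per row, from Kato's Euler system**, at ANY reduction type at `3`:
* §1 `portPairDeep_of_zetaBody_stable_pow` — from `ZetaBody` (`hbody`), `E[3]` irreducible, the (Λ)-clauses and
  riders (ii₂) at `(t, e)`, `hcdA`, the torsion-stabilisation binder `hstab` of level `M` over `3` and DISPLAYED value
  rows in w2-c3 g6's POW shape (`s̄ = u·3^t·(3^α·δ̃_n)`): the port at `(t + α, e, M)`.  = acc3 g4's ★₂-stable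
  (`KimAtThreeTwoExponentPortOfZetaBodyStable`) with the class shift `M` DECOUPLED from the torsion exponent and the
  pair taken from the prequel's ★★-stable-POW; the With-guard of depth `k + M` makes the primes Kolyvagin of level
  `3^{k+M+1}` (E1-deep), exactly what [MR04] Prop. A.2 needs at the place `3`.
* §2 `portPairDeep_of_zetaBody_of_valueRows_pow` — §1 with the value rows DISCHARGED by w2-c3 g6's
  `valueRow_of_zetaBody_pow` from the GENERAL value certificates (Kato's constant `uκ` `3`-integral, `uκ·a₃/3` and
  `uκ·𝟙_{3∤N}/3` integral, combined certificate `v₃(uκ·∏_{q∣3A}E_q(1)) = α`, cusp certificate a unit) — NO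
  reduction-type, Manin, period, `c₃` or local-torsion hypothesis beyond `hstab`.
* §3 `exists_shift_portPairDeep_of_zetaBody_of_valueRows_pow` — `hstab` discharged (`exists_hstab_three`): the port
  at `(t + α, e, M)` for SOME `M`.
Sequel `KimAtThreeDeepLowerUniformOfFineKato`: with w2-c3 g6's uniform fine Kato package (C1ᵤ) and certificate
supply (C2ᵤ, a THEOREM) this gives 19075 / 19679 / 19076 / 19562 / `N11.KimAtThreeDeepPUB` BY NAME from
{[S24] (1)(2) PINNED, GZK, PT, Carayol} ∧ (C1ᵤ) alone.

HONEST LIMITS: (Λ)/(ii₂)/`ZetaBody` are hypotheses on BOUND witnesses (CONSTRUCTION-SHAPED; the cell's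
`defn-BlochKatoDualExponential` lane); closes nothing; 0 defs / 0 facts / 0 sorry.  Credit: acc3 (★₂/★★-stable),
acc6 (two-exponent chain), w2-c3 (D-u, StableThree, POW value rows, `exists_hstab_three`), acc1 (deep ENDs), team
n1011 (originals); this seat re-keys.
References: [Kato2004Asterisque] (8.1.3), §9.4, Thm. 9.7, Thm. 6.6 (1), Ex. 13.3; [Kim2022StructureSelmer] §2.2.2,
Lemma 3.4, §3.2.3, §3.3–§3.4.1, Thm. 3.13; [MazurRubin2004] Def. 3.1.3, Thm. 3.2.4, App. A Prop. A.2, Remark A.5;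
[Sakamoto2024] §2, Def. 4.1; [Kim2025RefinedTNC] §4.2, §5, §8.1.2.
-/

set_option autoImplicit false
-- the Theorems namespace of a single-conjunct summit repeats the summit name by design (D-0017)
set_option linter.dupNamespace false

noncomputable section

open scoped NumberField TensorProduct ContRepresentation Classical
open CategoryTheory Field Function Finset IsDedekindDomain NumberField WeierstrassCurve
open Rat.HeightOneSpectrum
open Literature.NumberTheory.GaloisRepresentations Literature.NumberTheory.GaloisCohomology
open Literature.NumberTheory.GaloisRepresentations.DiscreteGaloisModule
open Literature.NumberTheory.EllipticCurves Literature.NumberTheory.EllipticCurves.ModularForms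
open Literature.NumberTheory.EllipticCurves.Rank1Residual
open Literature.NumberTheory.EllipticCurves.Kato2004
open Literature.NumberTheory.EllipticCurves.Kato2004.EulerSystemValues
open Summit.BirchSwinnertonDyer.Rank1Residual.GaloisImage
open Summit.BirchSwinnertonDyer.BirchSwinnertonDyer.Theorems.KimAtThreeKolyvaginDefs
open Summit.BirchSwinnertonDyer.BirchSwinnertonDyer.Theorems
open Summit.BirchSwinnertonDyer.BirchSwinnertonDyer.Theorems.KimAtThreeDeepUpperValueRowsAnomalous
open Summit.BirchSwinnertonDyer.BirchSwinnertonDyer.Theorems.KimAtThreeDeepUpperWitnessOfZetaBodyStable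
open Summit.BirchSwinnertonDyer.BirchSwinnertonDyer.Theorems.KimAtThreeDeepLowerWitnessPairStablePow

namespace Summit.BirchSwinnertonDyer.BirchSwinnertonDyer.Theorems.KimAtThreeDeepLowerPortPairOfZetaBodyPow

variable (W : WeierstrassCurve ℚ) [W.IsElliptic] [W.IsGloballyMinimal]
  [ContinuousSMul ℤ_[3] (W.tateModule 3)] [Module.Free ℤ_[3] (W.tateModule 3)]
  [Module.Finite ℤ_[3] (W.tateModule 3)]

/-- Local notation: `𝐃F⟦r, τ⟧ ℓ = Σ_{j<ℓ−1} j·σ_{χ_{m(0,r)}(τ_ℓ)}^j` on the level field `ℚ(ζ_{m(0,r)})`. -/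
local notation3 (prettyPrint := false) "𝐃F⟦" r ", " τ "⟧" =>
  fun ℓ : HeightOneSpectrum (𝓞 ℚ) =>
  ∑ j ∈ Finset.range (((primesEquiv ℓ : Nat.Primes) : ℕ) - 1),
    (j : Module.End ℚ (CyclotomicField (cycLevel 3 0 r) ℚ)) *
      (sigma (cycLevel 3 0 r) (modNCyclotomicCharacter ℚ (cycLevel 3 0 r)
          ((τ : HeightOneSpectrum (𝓞 ℚ) → absoluteGaloisGroup ℚ) ℓ)) :
        CyclotomicField (cycLevel 3 0 r) ℚ →ₐ[ℚ] CyclotomicField (cycLevel 3 0 r) ℚ).toLinearMap ^ j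

/-- Local notation: the TWO-EXPONENT rider clause (ii₂) at depth `j`, torsion exponent `t`, defect exponent
`e`, place `v`, for the pair `(Λ, Λf)` — n1011's `KatoExpStarFiniteLevelAt` clause (ii) with the conclusion
multiplied by `3^e` (seat acc6's spelling). -/
local notation3 (prettyPrint := false) "RIDER₂⟦" W' ", " j ", " t' ", " e' ", " v' ", " Λ' ", " Λf "⟧" =>
  ∀ (r : Finset (HeightOneSpectrum (𝓞 ℚ)))
    (Ψ : H1 (tateRep W' 3) (cycSubgroup 3 0 r) →+
      continuousCohomology 1
        (subgroupRep (WeierstrassCurve.torsionGaloisModule W' (((3 : ℕ) : ℤ) ^ j * ((3 : ℕ) : ℤ))).toTopRep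
          (cycSubgroup 3 0 r))),
    (∀ (φ : contOneCocycles (subgroupRep (tateRep W' 3).toTopRep (cycSubgroup 3 0 r)))
        (ψ : contOneCocycles
          (subgroupRep (WeierstrassCurve.torsionGaloisModule W' (((3 : ℕ) : ℤ) ^ j * ((3 : ℕ) : ℤ))).toTopRep
            (cycSubgroup 3 0 r))),
        (∀ g, ((ψ.1 g : geomTorsion W' (((3 : ℕ) : ℤ) ^ j * ((3 : ℕ) : ℤ))) : geomPoints W') =
          TateModule.proj 3 (j + 1) (φ.1 g)) →
        Ψ (oneCocycleClass _ φ) = oneCocycleClass _ ψ) →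
    ∀ (y : H1 (tateRep W' 3) (cycSubgroup 3 0 r))
      (κ₀ : galoisCohomology (WeierstrassCurve.torsionGaloisModule W' (((3 : ℕ) : ℤ) ^ j * ((3 : ℕ) : ℤ))) 1)
      (s : ℤ_[3]),
      resSubgroup (WeierstrassCurve.torsionGaloisModule W' (((3 : ℕ) : ℤ) ^ j * ((3 : ℕ) : ℤ))).toTopRep
          (cycSubgroup 3 0 r) 1 κ₀ = Ψ y →
      galoisCohomology.localization (WeierstrassCurve.torsionGaloisModule W' (((3 : ℕ) : ℤ) ^ j * ((3 : ℕ) : ℤ)))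
          (Sum.inr v') 1 κ₀ ∈ propagatedSelmerStructure W' 3 j (Sum.inr v') →
      (∃ l ∈ cycIntLattice 3 (cycLevel 3 0 r),
          (((3 : ℕ) : ℤ_[3]) ^ t') • Λ' 0 r y - ((s : ℚ_[3]) ⊗ₜ[ℚ] (1 : CyclotomicField (cycLevel 3 0 r) ℚ)) =
            (((3 : ℕ) : ℤ_[3]) ^ (j + 1)) • (l : ℚ_[3] ⊗[ℚ] CyclotomicField (cycLevel 3 0 r) ℚ)) →
      ((3 ^ e' : ℕ) : ZMod (3 ^ (j + 1))) *
        Λf (galoisCohomology.localization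
          (WeierstrassCurve.torsionGaloisModule W' (((3 : ℕ) : ℤ) ^ j * ((3 : ℕ) : ℤ))) (Sum.inr v') 1 κ₀) =
        PadicInt.toZModPow (j + 1) s

/-- Local notation: **the DEEP-GUARD TWO-DEPTH PORT at `(t, e, M)`** for `(W, v₃, η, P)` — the `hPort` binder of
this seat's gen-6 `deepLower_row_of_portDeep_tors` / `deepUpper_row_of_portDeep_tors` VERBATIM: for all depths
`k ≤ k′`, all `τ`-data with the n1011 (B6) guards of depth `k + M` / `k′ + M`, every pinned reduction `red`,
two-exponent witnesses at both depths + (COMP). -/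
local notation3 (prettyPrint := false) "PORTPAIR⟦" W' ", " t' ", " e' ", " M' ", " v' ", " η' ", " P' "⟧" =>
  ∀ (k k' : ℕ) (Dk : KolyvaginDatum (WeierstrassCurve.torsionGaloisModule W' (((3 : ℕ) : ℤ) ^ k * ((3 : ℕ) : ℤ))))
    (Dk' : KolyvaginDatum (WeierstrassCurve.torsionGaloisModule W' (((3 : ℕ) : ℤ) ^ k' * ((3 : ℕ) : ℤ))))
    (red : (WeierstrassCurve.torsionGaloisModule W' (((3 : ℕ) : ℤ) ^ k' * ((3 : ℕ) : ℤ))).toContRepresentation →ⁱL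
      (WeierstrassCurve.torsionGaloisModule W' (((3 : ℕ) : ℤ) ^ k * ((3 : ℕ) : ℤ))).toContRepresentation),
    Dk.IsCanonicalTauDatumThreeAtWith W' (k + M') k η' → Dk'.IsCanonicalTauDatumThreeAtWith W' (k' + M') k' η' →
    k ≤ k' →
    (∀ x : geomTorsion W' (((3 : ℕ) : ℤ) ^ k' * ((3 : ℕ) : ℤ)),
      ((red x : geomTorsion W' (((3 : ℕ) : ℤ) ^ k * ((3 : ℕ) : ℤ))) : geomPoints W') =
        (((3 : ℕ) : ℤ) ^ (k' - k)) • (x : geomPoints W')) →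
    ∃ κ Λ κ' κu Λu κu',
      KatoKuriharaWitnessAtTwoExp W' k t' e' Dk v' P' κ Λ κ' ∧
      KatoKuriharaWitnessAtTwoExp W' k' t' e' Dk' v' P' κu Λu κu' ∧
      ∀ d, Dk'.IsLevel d → Dk.IsLevel d →
        galoisCohomology.map red 1 (κu d) = κ d ∧ galoisCohomology.map red 1 (κu' d) = κ' d

/-! ### §1 The port at `(t + α, e, M)` from `ZetaBody` + riders + `hstab` + displayed POW value rows -/

set_option backward.isDefEq.respectTransparency false in
/-- **§1 The deep-guard two-depth port at `(t + α, e, M)` for `(W, v₃, η, P)` from Kato's Euler system, any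
reduction type at `3`.**  Displayed: the parametrisation datum `P` at the conductor level (`hN`), Kato's witnesses
through `hbody` for `P.f`, `E[3]` irreducible, the functionals `Λfin j` with the (Λ)-clauses `hΛ` and the
two-exponent riders `hfin₂` at `(t, e)`, `hcdA`, the torsion-stabilisation binder `hstab` of level `M` over the
place(s) of `3` (no `ℚ_w`-point of order `3^{M+1}`; any reduction type, any `#E(ℚ₃)[3]`), and the per-level VALUE
ROWS at exponent `t` in the POW shape (`hvalue`, displayed).  acc3 g4's ★₂-stable with `t ↦ M` in the guards and
the pair from ★★-stable-POW: the With-guards make the primes of `Dk` / `Dk′` Kolyvagin primes of level `3^{k+M+1}` /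
`3^{k′+M+1}` (E1-deep `isKolyvaginPrime_of_mem_frobeniusClassPrimes_of_le`), hence usable for Kato's system
(`hcdA`, `hN`). [cite: MazurRubin2004, Def. 3.1.3, Thm. 3.2.4 and App. A Prop. A.2 (pp. 79–80), Remark A.5]
[cite: Kato2004Asterisque, (8.1.3) (p. 180), §9.4 (p. 188) and Thm. 9.7 (p. 189)]
[cite: Kim2022StructureSelmer, Thm. 3.13 and §2.2.2, §3.2.3, §3.3–§3.4.1 (arXiv v3 pp. 12, 16–18, 26–27)]
[cite: Sakamoto2024, §2 and Def. 4.1] [cite: Kim2025RefinedTNC, §4.2, §5 and §8.1.2] -/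
theorem portPairDeep_of_zetaBody_stable_pow
    {N : ℕ} [NeZero N] (P : ModularParametrizationData W N) (hN : N = W.conductorNorm ℤ)
    {ι : (n : ℕ) → (CyclotomicField n ℚ →+* ℂ)} {κK : ℝ}
    {Λ : ∀ (k' : ℕ) (r : Finset (HeightOneSpectrum (𝓞 ℚ))),
      H1 (tateRep W 3) (cycSubgroup 3 k' r) →ₗ[ℤ_[3]] ℚ_[3] ⊗[ℚ] CyclotomicField (cycLevel 3 k' r) ℚ}
    {c d a : ℤ} {A : ℕ}
    {z : ∀ (k' : ℕ) (r : (cyclotomicLevelsRat 3 (badPlaces c d A N)).Ideals),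
      H1 (tateRep W 3) ((cyclotomicLevelsRat 3 (badPlaces c d A N)).level k' r.1)}
    {x : ∀ (k' : ℕ) (r : (cyclotomicLevelsRat 3 (badPlaces c d A N)).Ideals),
      CyclotomicField (cycLevel 3 k' r.1) ℚ}
    (hbody : ZetaBody W 3 P.f ι κK Λ c d a A z x)
    (hirr : W.HasIrreducibleModPGaloisRep 3)
    {M : ℕ}
    (hstab : ∀ v : HeightOneSpectrum (𝓞 ℚ), ((primesEquiv v : Nat.Primes) : ℕ) = 3 →
      ∀ Q : (W.baseChange (v.adicCompletion ℚ)).toAffine.Point, 3 ^ (M + 1) • Q = 0 → 3 ^ M • Q = 0)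
    {t e α : ℕ} {v₃ : HeightOneSpectrum (𝓞 ℚ)} (hv₃ : ((3 : ℕ) : 𝓞 ℚ) ∈ v₃.asIdeal)
    (Λfin : ∀ j : ℕ, galoisCohomology ((W.torsionGaloisModule (((3 : ℕ) : ℤ) ^ j * ((3 : ℕ) : ℤ))).toLocal
      (Sum.inr v₃)) 1 →+ ZMod (3 ^ (j + 1)))
    (hΛ : ∀ j : ℕ,
      (∀ c : ZMod (3 ^ (j + 1)), ∃ x ∈ propagatedSelmerStructure W 3 j (Sum.inr v₃), Λfin j x = c) ∧
      (∀ x ∈ propagatedSelmerStructure W 3 j (Sum.inr v₃),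
        Λfin j x = 0 ↔ x ∈ W.kummerSelmerStructure (((3 : ℕ) : ℤ) ^ j * ((3 : ℕ) : ℤ)) (Sum.inr v₃)))
    (hfin₂ : ∀ j : ℕ, RIDER₂⟦W, j, t, e, v₃, Λ, Λfin j⟧)
    {η : (q : HeightOneSpectrum (𝓞 ℚ)) → (ZMod (Ideal.absNorm q.asIdeal))ˣ}
    (hcdA : ∀ q : ℕ, q.Prime → q ≡ 1 [MOD 3] → ¬ q ∣ 2 * c.natAbs * d.natAbs * A)
    (hvalue : ∀ (j : ℕ) (σ : HeightOneSpectrum (𝓞 ℚ) → absoluteGaloisGroup ℚ),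
      (∀ q, σ q ∈ (adicCompletionPrime ℚ q).inertia (absoluteGaloisGroup ℚ)) →
      (∀ q, modNCyclotomicCharacter ℚ (Ideal.absNorm q.asIdeal) (σ q) = η q) →
      ∀ (r : Finset (HeightOneSpectrum (𝓞 ℚ)))
        (hr : ∀ q ∈ r, q ∈ (cyclotomicLevelsRat 3 (badPlaces c d A N)).primes),
        (∀ q ∈ r, Kato.IsKolyvaginPrime W 3 (j + 1) ((primesEquiv q : Nat.Primes) : ℕ)) →
        (∀ q ∈ r, Subgroup.zpowers (η q) = ⊤) →
        ∃ (s : ℤ_[3]) (u : (ZMod (3 ^ (j + 1)))ˣ)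
          (ψ : (ℓ : ℕ) → (ZMod ℓ)ˣ →* Multiplicative (ZMod (3 ^ (j + 1)))),
          (∀ q ∈ r, Function.Surjective (ψ (Ideal.absNorm q.asIdeal))) ∧
          (∃ l ∈ cycIntLattice 3 (cycLevel 3 0 r),
            (((3 : ℕ) : ℤ_[3]) ^ t) • ((1 : ℚ_[3]) ⊗ₜ[ℚ]
              ((r.noncommProd 𝐃F⟦r, σ⟧ (ZetaValue.pairwise_commute_fieldDeriv (cycLevel 3 0 r)
                  (fun ℓ => modNCyclotomicCharacter ℚ (cycLevel 3 0 r) (σ ℓ))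
                  (fun ℓ => ((primesEquiv ℓ : Nat.Primes) : ℕ) - 1) r))
                (x 0 ⟨r, hr⟩ + sigma (cycLevel 3 0 r) (-1) (x 0 ⟨r, hr⟩)))) -
              ((s : ℚ_[3]) ⊗ₜ[ℚ] (1 : CyclotomicField (cycLevel 3 0 r) ℚ)) =
            (((3 : ℕ) : ℤ_[3]) ^ (j + 1)) • (l : ℚ_[3] ⊗[ℚ] CyclotomicField (cycLevel 3 0 r) ℚ)) ∧
          haveI : NeZero (∏ q ∈ r, Ideal.absNorm q.asIdeal) :=
            ⟨Finset.prod_ne_zero_iff.2 fun q _ h => q.ne_bot (Ideal.absNorm_eq_zero_iff.1 h)⟩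
          PadicInt.toZModPow (j + 1) s = (u : ZMod (3 ^ (j + 1))) *
            ((3 : ℕ) : ZMod (3 ^ (j + 1))) ^ t *
              (((3 : ℕ) : ZMod (3 ^ (j + 1))) ^ α *
                kuriharaNumber P.f (3 ^ (j + 1)) (∏ q ∈ r, Ideal.absNorm q.asIdeal) ψ)) :
    PORTPAIR⟦W, t + α, e, M, v₃, η, P⟧ := by
  intro k k' D D' red hDW hDW' hkk' hred
  -- the guards
  obtain ⟨hT, hC, S, τ, hS, hτμ, hτq, hP⟩ := hDW
  obtain ⟨hT', hC', S', τ', hS', hτμ', hτq', hP'⟩ := hDW'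
  -- Kolyvagin primes of levels `k + M + 1`, `k′ + M + 1` (E1-deep on the deep classes of the With-guards: this is
  -- where the guard depth `k + M` pays for the place `3`, [MR04] Prop. A.2)
  have hKol : ∀ q ∈ D.primes, Kato.IsKolyvaginPrime W 3 (k + M + 1) ((primesEquiv q : Nat.Primes) : ℕ) :=
    fun q hq => KolyvaginPrime.isKolyvaginPrime_of_mem_frobeniusClassPrimes_of_le W
      (le_refl (k + M)) (fun v hv => (hS v hv).1) hτμ hτq (hP hq)
  have hKol' : ∀ q ∈ D'.primes, Kato.IsKolyvaginPrime W 3 (k' + M + 1) ((primesEquiv q : Nat.Primes) : ℕ) :=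
    fun q hq => KolyvaginPrime.isKolyvaginPrime_of_mem_frobeniusClassPrimes_of_le W
      (le_refl (k' + M)) (fun v hv => (hS' v hv).1) hτμ' hτq' (hP' hq)
  -- every Kolyvagin prime is a usable prime of Kato's system for `(c, d, A, N)`
  have husable : ∀ (j : ℕ) (q : HeightOneSpectrum (𝓞 ℚ)),
      Kato.IsKolyvaginPrime W 3 (j + 1) ((primesEquiv q : Nat.Primes) : ℕ) →
        q ∈ (cyclotomicLevelsRat 3 (badPlaces c d A N)).primes := by
    intro j q hq
    have hℓ := hq.prime
    have h13 : ((primesEquiv q : Nat.Primes) : ℕ) ≡ 1 [MOD 3] :=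
      hq.modEq_one.of_dvd (dvd_pow_self 3 (Nat.succ_ne_zero j))
    refine (mem_primes_cyclotomicLevelsRat_badPlaces_iff 3 c d A N q).2 ⟨fun hdvd => ?_, hq.ne⟩
    rcases (Nat.Prime.dvd_mul hℓ).mp hdvd with h | h
    · exact hcdA _ hℓ h13 h
    · apply hq.not_dvd
      rw [← hN]
      exact dvd_mul_of_dvd_left h 3
  have hPr : D.primes ⊆ (cyclotomicLevelsRat 3 (badPlaces c d A N)).primes :=
    fun q hq => husable (k + M) q (hKol q hq)
  have hPr' : D'.primes ⊆ (cyclotomicLevelsRat 3 (badPlaces c d A N)).primes :=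
    fun q hq => husable (k' + M) q (hKol' q hq)
  -- the two-exponent witness package at the two depths + (COMP) (★★-stable-POW at `N₀ = M`), value rows `hvalue`
  obtain ⟨κf, κu, h₁, h₂, h₃⟩ :=
    exists_katoKuriharaWitnessAtTwoExp_pair_of_zetaBody_of_stable_pow
      W P hbody hirr hkk' red hred hv₃ (hΛ k) (hΛ k') (hfin₂ k) (hfin₂ k') D hT D' hT' hC hC' hPr hPr'
      hstab hKol hKol'
      (fun σ hI hχ r hr => hvalue k σ hI hχ r (fun q hq => hPr (hr (Finset.mem_coe.2 hq)))
        (fun q hq => (hKol q (hr (Finset.mem_coe.2 hq))).mono (by omega))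
        (fun q hq => hC.zpowers_eq_top (hr (Finset.mem_coe.2 hq))))
      (fun σ hI hχ r hr => hvalue k' σ hI hχ r (fun q hq => hPr' (hr (Finset.mem_coe.2 hq)))
        (fun q hq => (hKol' q (hr (Finset.mem_coe.2 hq))).mono (by omega))
        (fun q hq => hC'.zpowers_eq_top (hr (Finset.mem_coe.2 hq))))
  exact ⟨κf, Λfin k, κf, κu, Λfin k', κu, h₁, h₂, fun l hl' hl => ⟨h₃ l hl' hl, h₃ l hl' hl⟩⟩

/-! ### §2 The value rows discharged: the GENERAL value certificates (any reduction type) -/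

set_option backward.isDefEq.respectTransparency false in
/-- **§2 The deep-guard two-depth port at `(t + α, e, M)` from `ZetaBody`, value rows DISCHARGED** by w2-c3 g6's
`valueRow_of_zetaBody_pow` (`hf := P.isNewformOf`).  Displayed: `hbody`, `hirr`, `hstab` (level `M`), the
functionals with (Λ)-clauses and (ii₂) riders at `(t, e)`, `hcdA`, and the GENERAL value certificates
`uκ`/`huκ`/`hκ0`/`huκ1`, `d′`/`hcd`/`hdd′`, `hAN`, `aM`/`haM`, `hκa`/`hκ1` (integrality of `uκ·a₃/3`,
`uκ·𝟙_{3∤N}/3`), `hE0`, the combined certificate `hκE` (`= α`), `hR0`/`hR`.  NO reduction-type, `ht0`, bad-place,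
Manin or period hypothesis.
[cite: Kato2004Asterisque, (8.1.3) (p. 180), §9.4 (p. 188), Thm. 9.7 (p. 189), Thm. 6.6 (1) (p. 163) and Ex. 13.3 (pp. 224–225)]
[cite: Kim2022StructureSelmer, Thm. 3.13, Lemma 3.4 and §2.2.2, §3.4.1–§3.5] [cite: MazurRubin2004, App. A Prop. A.2 and Thm. 3.2.4] -/
theorem portPairDeep_of_zetaBody_of_valueRows_pow
    {N : ℕ} [NeZero N] (P : ModularParametrizationData W N) (hN : N = W.conductorNorm ℤ)
    {ι : (n : ℕ) → (CyclotomicField n ℚ →+* ℂ)} {κK : ℝ}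
    {Λ : ∀ (k' : ℕ) (r : Finset (HeightOneSpectrum (𝓞 ℚ))),
      H1 (tateRep W 3) (cycSubgroup 3 k' r) →ₗ[ℤ_[3]] ℚ_[3] ⊗[ℚ] CyclotomicField (cycLevel 3 k' r) ℚ}
    {c d a : ℤ} {A : ℕ} [NeZero A]
    {z : ∀ (k' : ℕ) (r : (cyclotomicLevelsRat 3 (badPlaces c d A N)).Ideals),
      H1 (tateRep W 3) ((cyclotomicLevelsRat 3 (badPlaces c d A N)).level k' r.1)}
    {x : ∀ (k' : ℕ) (r : (cyclotomicLevelsRat 3 (badPlaces c d A N)).Ideals),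
      CyclotomicField (cycLevel 3 k' r.1) ℚ}
    (hbody : ZetaBody W 3 P.f ι κK Λ c d a A z x)
    (hirr : W.HasIrreducibleModPGaloisRep 3)
    {M : ℕ}
    (hstab : ∀ v : HeightOneSpectrum (𝓞 ℚ), ((primesEquiv v : Nat.Primes) : ℕ) = 3 →
      ∀ Q : (W.baseChange (v.adicCompletion ℚ)).toAffine.Point, 3 ^ (M + 1) • Q = 0 → 3 ^ M • Q = 0)
    {t e α : ℕ} {v₃ : HeightOneSpectrum (𝓞 ℚ)} (hv₃ : ((3 : ℕ) : 𝓞 ℚ) ∈ v₃.asIdeal)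
    (Λfin : ∀ j : ℕ, galoisCohomology ((W.torsionGaloisModule (((3 : ℕ) : ℤ) ^ j * ((3 : ℕ) : ℤ))).toLocal
      (Sum.inr v₃)) 1 →+ ZMod (3 ^ (j + 1)))
    (hΛ : ∀ j : ℕ,
      (∀ c : ZMod (3 ^ (j + 1)), ∃ x ∈ propagatedSelmerStructure W 3 j (Sum.inr v₃), Λfin j x = c) ∧
      (∀ x ∈ propagatedSelmerStructure W 3 j (Sum.inr v₃),
        Λfin j x = 0 ↔ x ∈ W.kummerSelmerStructure (((3 : ℕ) : ℤ) ^ j * ((3 : ℕ) : ℤ)) (Sum.inr v₃)))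
    (hfin₂ : ∀ j : ℕ, RIDER₂⟦W, j, t, e, v₃, Λ, Λfin j⟧)
    {η : (q : HeightOneSpectrum (𝓞 ℚ)) → (ZMod (Ideal.absNorm q.asIdeal))ˣ}
    (hcdA : ∀ q : ℕ, q.Prime → q ≡ 1 [MOD 3] → ¬ q ∣ 2 * c.natAbs * d.natAbs * A)
    -- the VALUE certificates, GENERAL shape (w2-c3's `valueRow_of_zetaBody_general` / `_pow`), level-free
    (uκ : ℚ) (huκ : (uκ : ℝ) = κK) (hκ0 : κK ≠ 0) (huκ1 : ‖(uκ : ℚ_[3])‖ ≤ 1)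
    (d' : ℤ) (hcd : Int.gcd (c * d) A = 1) (hdd' : d * d' ≡ 1 [ZMOD (A : ℤ)])
    (hAN : Nat.Coprime A N)
    (aM : ℕ → ℤ) (haM : ∀ q ∈ (3 * A).primeFactors, cuspCoeff P.f q = aM q)
    (hκa : ‖((uκ * ((aM 3 : ℚ) / (3 : ℕ)) : ℚ) : ℚ_[3])‖ ≤ 1)
    (hκ1 : ‖((uκ * (if 3 ∣ N then 0 else (1 / (3 : ℕ) : ℚ)) : ℚ) : ℚ_[3])‖ ≤ 1)
    (hE0 : ∏ q ∈ (3 * A).primeFactors, (1 - (aM q : ℚ) / q + (if q ∣ N then 0 else (1 / q : ℚ))) ≠ 0)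
    (hκE : padicValRat 3
      (uκ * ∏ q ∈ (3 * A).primeFactors, (1 - (aM q : ℚ) / q + (if q ∣ N then 0 else (1 / q : ℚ)))) = α)
    (hR0 : (c : ℚ) ^ 2 * (d : ℚ) ^ 2 * ratMinusSymbol P.f ((a : ℚ) / A) -
        (c : ℚ) * (d : ℚ) ^ 2 * ratMinusSymbol P.f ((a * c : ℚ) / A) -
        (c : ℚ) ^ 2 * (d : ℚ) * ratMinusSymbol P.f ((a * d' : ℚ) / A) +
        (c : ℚ) * (d : ℚ) * ratMinusSymbol P.f ((a * c * d' : ℚ) / A) ≠ 0)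
    (hR : padicValRat 3 ((c : ℚ) ^ 2 * (d : ℚ) ^ 2 * ratMinusSymbol P.f ((a : ℚ) / A) -
        (c : ℚ) * (d : ℚ) ^ 2 * ratMinusSymbol P.f ((a * c : ℚ) / A) -
        (c : ℚ) ^ 2 * (d : ℚ) * ratMinusSymbol P.f ((a * d' : ℚ) / A) +
        (c : ℚ) * (d : ℚ) * ratMinusSymbol P.f ((a * c * d' : ℚ) / A)) = 0) :
    PORTPAIR⟦W, t + α, e, M, v₃, η, P⟧ :=
  portPairDeep_of_zetaBody_stable_pow W P hN hbody hirr hstab hv₃ Λfin hΛ hfin₂ hcdA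
    fun j σ hσI hσχ r hr hKol hη => valueRow_of_zetaBody_pow hbody P.isNewformOf (by decide) hirr uκ huκ
      hκ0 huκ1 d' hcd hdd' hAN aM haM hκa hκ1 hE0 α hκE hR0 hR η j t σ hσI hσχ r hr hKol hη

/-! ### §3 The binder `hstab` discharged: the port at SOME class shift on every curve -/

set_option backward.isDefEq.respectTransparency false in
/-- **§3 The deep-guard two-depth port at `(t + α, e, M)` for SOME torsion-stabilisation level `M`**, from
`ZetaBody`, riders and the general value certificates, NO LOCAL HYPOTHESIS AT `3`: §2 with `hstab` discharged by
w2-c3's `exists_hstab_three` (the `3`-power torsion of `E(ℚ₃)` is finite; in nature `M = N₀ ≤ 2` at an additive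
`3`, `0` when `E(ℚ₃)[3] = 0`). [cite: MazurRubin2004, App. A Prop. A.2 (p. 79) and its proof (p. 80)]
[cite: Kato2004Asterisque, (8.1.3) (p. 180), §9.4 (p. 188), Thm. 9.7 (p. 189) and Ex. 13.3 (pp. 224–225)]
[cite: Kim2022StructureSelmer, Thm. 3.13 and §2.2.2] -/
theorem exists_shift_portPairDeep_of_zetaBody_of_valueRows_pow
    {N : ℕ} [NeZero N] (P : ModularParametrizationData W N) (hN : N = W.conductorNorm ℤ)
    {ι : (n : ℕ) → (CyclotomicField n ℚ →+* ℂ)} {κK : ℝ}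
    {Λ : ∀ (k' : ℕ) (r : Finset (HeightOneSpectrum (𝓞 ℚ))),
      H1 (tateRep W 3) (cycSubgroup 3 k' r) →ₗ[ℤ_[3]] ℚ_[3] ⊗[ℚ] CyclotomicField (cycLevel 3 k' r) ℚ}
    {c d a : ℤ} {A : ℕ} [NeZero A]
    {z : ∀ (k' : ℕ) (r : (cyclotomicLevelsRat 3 (badPlaces c d A N)).Ideals),
      H1 (tateRep W 3) ((cyclotomicLevelsRat 3 (badPlaces c d A N)).level k' r.1)}
    {x : ∀ (k' : ℕ) (r : (cyclotomicLevelsRat 3 (badPlaces c d A N)).Ideals),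
      CyclotomicField (cycLevel 3 k' r.1) ℚ}
    (hbody : ZetaBody W 3 P.f ι κK Λ c d a A z x)
    (hirr : W.HasIrreducibleModPGaloisRep 3)
    {t e α : ℕ} {v₃ : HeightOneSpectrum (𝓞 ℚ)} (hv₃ : ((3 : ℕ) : 𝓞 ℚ) ∈ v₃.asIdeal)
    (Λfin : ∀ j : ℕ, galoisCohomology ((W.torsionGaloisModule (((3 : ℕ) : ℤ) ^ j * ((3 : ℕ) : ℤ))).toLocal
      (Sum.inr v₃)) 1 →+ ZMod (3 ^ (j + 1)))
    (hΛ : ∀ j : ℕ,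
      (∀ c : ZMod (3 ^ (j + 1)), ∃ x ∈ propagatedSelmerStructure W 3 j (Sum.inr v₃), Λfin j x = c) ∧
      (∀ x ∈ propagatedSelmerStructure W 3 j (Sum.inr v₃),
        Λfin j x = 0 ↔ x ∈ W.kummerSelmerStructure (((3 : ℕ) : ℤ) ^ j * ((3 : ℕ) : ℤ)) (Sum.inr v₃)))
    (hfin₂ : ∀ j : ℕ, RIDER₂⟦W, j, t, e, v₃, Λ, Λfin j⟧)
    {η : (q : HeightOneSpectrum (𝓞 ℚ)) → (ZMod (Ideal.absNorm q.asIdeal))ˣ}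
    (hcdA : ∀ q : ℕ, q.Prime → q ≡ 1 [MOD 3] → ¬ q ∣ 2 * c.natAbs * d.natAbs * A)
    (uκ : ℚ) (huκ : (uκ : ℝ) = κK) (hκ0 : κK ≠ 0) (huκ1 : ‖(uκ : ℚ_[3])‖ ≤ 1)
    (d' : ℤ) (hcd : Int.gcd (c * d) A = 1) (hdd' : d * d' ≡ 1 [ZMOD (A : ℤ)])
    (hAN : Nat.Coprime A N)
    (aM : ℕ → ℤ) (haM : ∀ q ∈ (3 * A).primeFactors, cuspCoeff P.f q = aM q)
    (hκa : ‖((uκ * ((aM 3 : ℚ) / (3 : ℕ)) : ℚ) : ℚ_[3])‖ ≤ 1)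
    (hκ1 : ‖((uκ * (if 3 ∣ N then 0 else (1 / (3 : ℕ) : ℚ)) : ℚ) : ℚ_[3])‖ ≤ 1)
    (hE0 : ∏ q ∈ (3 * A).primeFactors, (1 - (aM q : ℚ) / q + (if q ∣ N then 0 else (1 / q : ℚ))) ≠ 0)
    (hκE : padicValRat 3
      (uκ * ∏ q ∈ (3 * A).primeFactors, (1 - (aM q : ℚ) / q + (if q ∣ N then 0 else (1 / q : ℚ)))) = α)
    (hR0 : (c : ℚ) ^ 2 * (d : ℚ) ^ 2 * ratMinusSymbol P.f ((a : ℚ) / A) -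
        (c : ℚ) * (d : ℚ) ^ 2 * ratMinusSymbol P.f ((a * c : ℚ) / A) -
        (c : ℚ) ^ 2 * (d : ℚ) * ratMinusSymbol P.f ((a * d' : ℚ) / A) +
        (c : ℚ) * (d : ℚ) * ratMinusSymbol P.f ((a * c * d' : ℚ) / A) ≠ 0)
    (hR : padicValRat 3 ((c : ℚ) ^ 2 * (d : ℚ) ^ 2 * ratMinusSymbol P.f ((a : ℚ) / A) -
        (c : ℚ) * (d : ℚ) ^ 2 * ratMinusSymbol P.f ((a * c : ℚ) / A) -
        (c : ℚ) ^ 2 * (d : ℚ) * ratMinusSymbol P.f ((a * d' : ℚ) / A) +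
        (c : ℚ) * (d : ℚ) * ratMinusSymbol P.f ((a * c * d' : ℚ) / A)) = 0) :
    ∃ M : ℕ, PORTPAIR⟦W, t + α, e, M, v₃, η, P⟧ := by
  obtain ⟨M, hstab⟩ := exists_hstab_three W
  exact ⟨M, portPairDeep_of_zetaBody_of_valueRows_pow W P hN hbody hirr hstab hv₃ Λfin hΛ hfin₂ hcdA uκ huκ hκ0
    huκ1 d' hcd hdd' hAN aM haM hκa hκ1 hE0 hκE hR0 hR⟩

end Summit.BirchSwinnertonDyer.BirchSwinnertonDyer.Theorems.KimAtThreeDeepLowerPortPairOfZetaBodyPow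

end
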